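import Summits.PneNP.PneNP.Theorems.SymmetryBudgetNoHiddenOrderProgramGates
import Summits.PneNP.PneNP.Theorems.SymmetryBudgetNoHiddenOrderWindowLabelsSym

/-!
# `NoHiddenOrder` (stmt-PneNP-14781), (R2c) VI support: the admissible labels `FLab m` — polynomially many, and the budget action on them

Route `PneNP/SymmetryBudget`.  `…ProgramGates.lean` (namespace `WCanon`) indexes the label groups of the window canoniser program by
`FLab m = {(U, X, λ : WV m → Fin (wn m)) // AdmB (Bw m) X λ}`.  As a TYPE this sits inside `Finset × Finset × (WV m → Fin (wn m))`, of size
`4^{wn} · wn^{wn} = m^{Θ(log log m)}`, so the size bound of the program needs the admissibility count; and the symmetry data `θ ρ` of the program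
needs the action of a budget permutation on `FLab m`.  This file supplies both:

* `toLab_injective`; **`card_FLab_le : Fintype.card (FLab m) ≤ m^18`** (`m ≥ 1`; `toLab` embeds `FLab m` into the cover `admLabels (Bw m)` of
  `…WindowLabels.lean`); `eventually_two_mul_card_add_two_le` (from `|Λ m| ≤ m^c` eventually to the `2|Λ|+2 ≤ q(m)` shape of
  `noHiddenOrder_of_graphProgram`, `q = 2X^c + 2`);
* `budgetPerm ρ hρ : Equiv.Perm (WV m)` — the restriction of `ρ ∈ Bud(m,⌊log₂ m⌋)` to the window type (`windowSet_preserved_of_mem_budget`),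
  `coe_budgetPerm`;
* `FLab.relabel σ : Equiv.Perm (FLab m)` for `σ : Equiv.Perm (WV m)` — `(U, X, λ) ↦ (σU, σX, λ ∘ σ⁻¹)` (`admB_relabel`) — with
  `toLab_relabel : toLab (FLab.relabel σ L) = (toLab L).relabel σ` (so `relabel_part` / `relabel_cand` of `…WindowLabelsSym.lean` apply).
Sorry-free; supports stmt-PneNP-14781, does not close it.
-/

set_option linter.dupNamespace false -- `Summit.PneNP.PneNP.…` (D-0017 single-conjunct layout)

namespace Summit.PneNP.PneNP.Theorems

open Finset Filter BranchSum Literature.Computability.Complexity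
open Summit.PneNP.PneNP.Theses.SymmetryBudget

namespace WCanon

/-! ### Counting -/

/-- `toLab` is injective: an admissible label is determined by the scheme label it denotes. [folklore] -/
theorem toLab_injective (m : ℕ) : Function.Injective (toLab (m := m)) := by
  rintro ⟨⟨U, X, lam⟩, hL⟩ ⟨⟨U', X', lam'⟩, hL'⟩ h
  simp only [toLab, CertifiedLabels.Label.mk.injEq] at h
  obtain ⟨rfl, rfl, hlam⟩ := h
  have : lam = lam' := funext fun v => Fin.ext (congrFun hlam v)
  subst this
  rfl

/-- **The admissible labels are polynomially many**: `|FLab m| ≤ m^18` for `m ≥ 1` (through the cover `admLabels (Bw m)`). [folklore] -/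
theorem card_FLab_le {m : ℕ} (hm : 0 < m) : Fintype.card (FLab m) ≤ m ^ 18 := by
  -- embed into the members of the cover
  let f : FLab m → ↥(admLabels (V := WV m) (Bw m)) := fun L => ⟨toLab L, mem_admLabels (L := toLab L) L.2⟩
  have hf : Function.Injective f := fun L L' h => toLab_injective m (congrArg Subtype.val h)
  refine (Fintype.card_le_of_injective f hf).trans ?_
  rw [Fintype.card_coe]
  have h := card_admLabels_windowSet_le hm
  rw [Fintype.card_coe] at h
  exact h

/-- **From a polynomial gate count to the size hypothesis of the socket**: if `|Λ m| ≤ m^c` for all large `m`, then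
`2|Λ m| + 2 ≤ q(m)` for all large `m` with `q = 2X^c + 2`. [folklore] -/
theorem eventually_two_mul_card_add_two_le {f : ℕ → ℕ} {c : ℕ} (h : ∀ᶠ m in atTop, f m ≤ m ^ c) :
    ∀ᶠ m in atTop, 2 * f m + 2 ≤ (2 * Polynomial.X ^ c + 2 : Polynomial ℕ).eval m := by
  refine h.mono fun m hm => ?_
  simp only [Polynomial.eval_add, Polynomial.eval_mul, Polynomial.eval_ofNat, Polynomial.eval_pow, Polynomial.eval_X]
  omega

/-! ### Budget permutations on the window type -/

/-- **The restriction of a budget permutation to the window type.** [folklore] -/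
def budgetPerm {m : ℕ} (ρ : Equiv.Perm (Fin m)) (hρ : ρ ∈ pointStabiliserBudget m (Nat.log 2 m)) : Equiv.Perm (WV m) :=
  ρ.subtypePerm fun v => windowSet_preserved_of_mem_budget hρ v

/-- The restriction acts as `ρ`. [folklore] -/
@[simp] theorem coe_budgetPerm {m : ℕ} (ρ : Equiv.Perm (Fin m)) (hρ : ρ ∈ pointStabiliserBudget m (Nat.log 2 m)) (v : WV m) :
    (budgetPerm ρ hρ v : Fin m) = ρ v := rfl

/-- The inverse of the restriction acts as `ρ⁻¹`. [folklore] -/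
@[simp] theorem coe_budgetPerm_symm {m : ℕ} (ρ : Equiv.Perm (Fin m)) (hρ : ρ ∈ pointStabiliserBudget m (Nat.log 2 m)) (v : WV m) :
    ((budgetPerm ρ hρ).symm v : Fin m) = ρ.symm v := rfl

/-! ### The action on admissible labels -/

/-- Relabelling the raw data of an admissible label. [folklore] -/
def FLab.relabelRaw {m : ℕ} (σ : Equiv.Perm (WV m)) (L : Finset (WV m) × Finset (WV m) × (WV m → Fin (wn m))) :
    Finset (WV m) × Finset (WV m) × (WV m → Fin (wn m)) :=
  (L.1.map σ.toEmbedding, L.2.1.map σ.toEmbedding, L.2.2 ∘ σ.symm)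

/-- Relabelling the raw data preserves admissibility. [folklore] -/
theorem FLab.admB_relabelRaw_iff {m : ℕ} (σ : Equiv.Perm (WV m)) (L : Finset (WV m) × Finset (WV m) × (WV m → Fin (wn m))) :
    AdmB (Bw m) (FLab.relabelRaw σ L).2.1 (fun v => ((FLab.relabelRaw σ L).2.2 v : ℕ)) ↔ AdmB (Bw m) L.2.1 fun v => (L.2.2 v : ℕ) := by
  unfold FLab.relabelRaw
  exact admB_relabel σ (X := L.2.1) (lam := fun v => (L.2.2 v : ℕ))

/-- Relabelling the raw data by `σ⁻¹` undoes relabelling by `σ`. [folklore] -/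
theorem FLab.relabelRaw_symm_relabelRaw {m : ℕ} (σ : Equiv.Perm (WV m)) (L : Finset (WV m) × Finset (WV m) × (WV m → Fin (wn m))) :
    FLab.relabelRaw σ.symm (FLab.relabelRaw σ L) = L := by
  obtain ⟨U, X, lam⟩ := L
  simp only [FLab.relabelRaw, Prod.mk.injEq]
  refine ⟨?_, ?_, ?_⟩
  · ext v; simp [Finset.mem_map_equiv]
  · ext v; simp [Finset.mem_map_equiv]
  · funext v; simp

/-- **The permutation of the admissible labels induced by a permutation of the window type** (the label part of `θ`). [folklore] -/
def FLab.relabel {m : ℕ} (σ : Equiv.Perm (WV m)) : Equiv.Perm (FLab m) where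
  toFun L := ⟨FLab.relabelRaw σ L.1, (FLab.admB_relabelRaw_iff σ L.1).2 L.2⟩
  invFun L := ⟨FLab.relabelRaw σ.symm L.1, (FLab.admB_relabelRaw_iff σ.symm L.1).2 L.2⟩
  left_inv L := Subtype.ext (FLab.relabelRaw_symm_relabelRaw σ L.1)
  right_inv L := Subtype.ext (by simpa using FLab.relabelRaw_symm_relabelRaw σ.symm L.1)

/-- The raw data of a relabelled admissible label. [folklore] -/
@[simp] theorem FLab.coe_relabel {m : ℕ} (σ : Equiv.Perm (WV m)) (L : FLab m) : (FLab.relabel σ L).1 = FLab.relabelRaw σ L.1 := rfl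

/-- The raw data of an inversely relabelled admissible label. [folklore] -/
@[simp] theorem FLab.coe_relabel_symm {m : ℕ} (σ : Equiv.Perm (WV m)) (L : FLab m) :
    ((FLab.relabel σ).symm L).1 = FLab.relabelRaw σ.symm L.1 := rfl

/-- **`toLab` intertwines the two actions**: `toLab (σ · L) = σ · toLab L`. [folklore] -/
theorem toLab_relabel {m : ℕ} (σ : Equiv.Perm (WV m)) (L : FLab m) : toLab (FLab.relabel σ L) = (toLab L).relabel σ := rfl

/-- The block of a relabelled admissible label. [folklore] -/
theorem toLab_relabel_U {m : ℕ} (σ : Equiv.Perm (WV m)) (L : FLab m) : (toLab (FLab.relabel σ L)).U = (toLab L).U.map σ.toEmbedding := rfl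

/-- The named set of a relabelled admissible label. [folklore] -/
theorem toLab_relabel_X {m : ℕ} (σ : Equiv.Perm (WV m)) (L : FLab m) : (toLab (FLab.relabel σ L)).X = (toLab L).X.map σ.toEmbedding := rfl

/-- The values of a relabelled admissible label. [folklore] -/
theorem toLab_relabel_lam {m : ℕ} (σ : Equiv.Perm (WV m)) (L : FLab m) : (toLab (FLab.relabel σ L)).lam = (toLab L).lam ∘ σ.symm := rfl

end WCanon

end Summit.PneNP.PneNP.Theorems
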